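import Literature.Probability.RandomPlanarGeometry.LocalMartingaleProofs
import Literature.Probability.Process.StoppedMartingale
import Mathlib.Probability.Process.FiniteDimensionalLaws
import Mathlib.MeasureTheory.Measure.HasOuterApproxClosed
import Mathlib.Probability.Independence.Integration
import HarnessLib

/-!
# The strong Markov property of Brownian motion

Topic `Probability/RandomPlanarGeometry` (it lives next to `LocalMartingaleProofs` and
`BrownianPathFreezing`, whose canonical Brownian motion `Process.brownian` on the pre-Wiener space
and raw natural filtration `brownianFiltration` it uses). Everything here is PROVED; no named fact
is introduced.

For a stopping time `τ` of the Brownian filtration `𝓕ᵂ` let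
`Z^τ_u = B_{τ+u} - B_τ` (`brownianIncrAfter τ u`, read where `τ < ∞`). We prove the **strong
Markov property** of the canonical Brownian motion (Le Gall, *Brownian Motion, Martingales, and
Stochastic Calculus* (2016), Thm. 2.20; Revuz–Yor (1999), Ch. III, Thm. (3.1); Mörters–Peres,
*Brownian Motion* (2010), Thm. 2.16): conditionally on `{τ < ∞}`, the process `Z^τ` is a Brownian
motion independent of `𝓕ᵂ_τ`. Precisely:

* `setIntegral_comp_brownianIncrAfter_of_countable_range` — for a stopping time with countably
  many values, `E[G(Z^τ); A ∩ {τ < ∞}] = E[G(B)] · P[A ∩ {τ < ∞}]` for every `A ∈ 𝓕ᵂ_τ` and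
  every bounded measurable functional `G` of the path (sum over the values, weak Markov property
  at each fixed time: Mathlib's `IsPreBrownianReal.indepFun_shift` and `IsPreBrownianReal.shift`);
* `setIntegral_comp_brownianIncrAfter` — the same identity for an ARBITRARY stopping time and
  `G` bounded, measurable and continuous for the product topology, by the dyadic approximation
  `τₙ ↓ τ` from above (`Process.dyadicCeilTop`, stopping times with countable range) and dominated
  convergence along the continuity of the Brownian paths — Le Gall's proof of Thm. 2.20;
* `map_brownianIncrAfter_restrict_eq` — the measure form
  `law(Z^τ; A ∩ {τ < ∞}) = P[A ∩ {τ < ∞}] · law(B)` on the path space `ℝ≥0 → ℝ` (product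
  σ-algebra): the finite-dimensional marginals are finite Borel measures on `ℝ^I` determined by
  bounded continuous functions (`ext_of_forall_integral_eq_of_IsFiniteMeasure`), and a measure on
  the path space is determined by its marginals (`IsProjectiveLimit.unique`);
* `measure_brownianIncrAfter_mem_inter` — `P[Z^τ ∈ S, A, τ < ∞] = P[B ∈ S] · P[A, τ < ∞]`;
* for an a.s. finite stopping time: `identDistrib_brownianIncrAfter` (`Z^τ` has the law of `B`),
  `indep_brownianIncrAfter` (`σ(Z^τ)` is independent of `𝓕ᵂ_τ`), `indepFun_brownianIncrAfter`
  (`Z^τ` is independent of every `𝓕ᵂ_τ`-measurable random variable), and the **freezing formula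
  at a stopping time** `integral_brownianIncrAfter_eq_integral_integral`:
  `E[F(X, Z^τ)] = E_ω[E_{ω'}[F(X(ω), B(ω'))]]` for `X` `𝓕ᵂ_τ`-measurable and `F` bounded jointly
  measurable — the form in which the strong Markov property is consumed by diffusions driven by
  `B` (restart the equation at time `τ` from the frozen state `X = (τ, Y_τ)`).

Mathlib has the weak Markov property at fixed times (`IsPreBrownianReal.indepFun_shift`,
`IsPreBrownianReal.shift`) and no strong Markov property; the tree had the fixed-time freezing
formula (`BrownianPathFreezing`). The filtration is the raw natural filtration `brownianFiltration`
(not completed, not right-continuous), so "stopping time" is the strict notion `{τ ≤ t} ∈ 𝓕ᵂ_t`.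

## References

* J.-F. Le Gall, *Brownian Motion, Martingales, and Stochastic Calculus*, Springer GTM 274 (2016),
  Thm. 2.20 (strong Markov property) and Prop. 3.8 (dyadic approximation). [Legall2016]
* D. Revuz, M. Yor, *Continuous Martingales and Brownian Motion* (1999), Ch. III, Thm. (3.1).
* P. Mörters, Y. Peres, *Brownian Motion*, CUP (2010), Thm. 2.16.
-/

noncomputable section

open MeasureTheory ProbabilityTheory Filter Set Function
open scoped NNReal ENNReal Topology

namespace Literature.Probability.RandomPlanarGeometry

open Literature.Probability.Process

/-! ### Joint measurability of the Brownian path and increments after a random time -/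

/-- The canonical Brownian motion is jointly measurable in `(t, ω)` (continuous paths, measurable
marginals). [folklore] -/
theorem measurable_uncurry_brownian : Measurable (Function.uncurry Process.brownian) :=
  measurable_uncurry_of_continuous_of_measurable (fun ω ↦ Process.continuous_brownian ω)
    Process.measurable_brownian

/-- `ω ↦ B_{ρ(ω)}(ω)` is measurable for a measurable random time `ρ`. [folklore] -/
theorem measurable_brownian_randomTime {ρ : (ℝ≥0 → ℝ) → ℝ≥0} (hρ : Measurable ρ) :
    Measurable fun ω ↦ Process.brownian (ρ ω) ω :=
  measurable_uncurry_brownian.comp (hρ.prodMk measurable_id)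

/-- **The Brownian increments after the random time `τ`**: `Z^τ_u(ω) = B_{τ(ω)+u}(ω) - B_{τ(ω)}(ω)`
(read on `{τ < ∞}`; on `{τ = ∞}` the documented junk value uses Mathlib's `WithTop.untopA`, as
`MeasureTheory.stoppedValue` does). Le Gall (2016), Thm. 2.20 (`B^{(T)}_t = 1_{T<∞}(B_{T+t} - B_T)`).
[cite: Legall2016, Thm. 2.20] -/
def brownianIncrAfter (τ : (ℝ≥0 → ℝ) → WithTop ℝ≥0) (u : ℝ≥0) (ω : ℝ≥0 → ℝ) : ℝ :=
  Process.brownian ((τ ω).untopA + u) ω - Process.brownian (τ ω).untopA ω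

/-- Unfolding lemma. [folklore] -/
theorem brownianIncrAfter_apply (τ : (ℝ≥0 → ℝ) → WithTop ℝ≥0) (u : ℝ≥0) (ω : ℝ≥0 → ℝ) :
    brownianIncrAfter τ u ω =
      Process.brownian ((τ ω).untopA + u) ω - Process.brownian (τ ω).untopA ω := rfl

/-- On `{τ = r}` the increments after `τ` are the increments after the fixed time `r`.
[folklore] -/
theorem brownianIncrAfter_of_eq_coe {τ : (ℝ≥0 → ℝ) → WithTop ℝ≥0} {ω : ℝ≥0 → ℝ} {r : ℝ≥0}
    (h : τ ω = r) (u : ℝ≥0) :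
    brownianIncrAfter τ u ω = Process.brownian (r + u) ω - Process.brownian r ω := by
  rw [brownianIncrAfter_apply, h]
  rfl

/-- The increment process after `τ` starts at `0`. [folklore] -/
@[simp] theorem brownianIncrAfter_zero (τ : (ℝ≥0 → ℝ) → WithTop ℝ≥0) (ω : ℝ≥0 → ℝ) :
    brownianIncrAfter τ 0 ω = 0 := by
  simp [brownianIncrAfter_apply]

/-- The increment process after `τ` has continuous paths. [folklore] -/
theorem continuous_brownianIncrAfter (τ : (ℝ≥0 → ℝ) → WithTop ℝ≥0) (ω : ℝ≥0 → ℝ) :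
    Continuous fun u ↦ brownianIncrAfter τ u ω :=
  ((Process.continuous_brownian ω).comp (continuous_const.add continuous_id)).sub continuous_const

/-- Each coordinate of the increment process after a measurable random time is measurable.
[folklore] -/
theorem measurable_brownianIncrAfter {τ : (ℝ≥0 → ℝ) → WithTop ℝ≥0} (hτ : Measurable τ)
    (u : ℝ≥0) : Measurable (brownianIncrAfter τ u) :=
  (measurable_brownian_randomTime (hτ.untopA.add_const u)).sub
    (measurable_brownian_randomTime hτ.untopA)

/-- The increment process after a measurable random time is a measurable random path (product
σ-algebra). [folklore] -/
theorem measurable_brownianIncrAfter_pi {τ : (ℝ≥0 → ℝ) → WithTop ℝ≥0} (hτ : Measurable τ) :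
    Measurable fun ω u ↦ brownianIncrAfter τ u ω :=
  measurable_pi_lambda _ fun u ↦ measurable_brownianIncrAfter hτ u

/-- The canonical Brownian path `ω ↦ (u ↦ B_u(ω))` is a measurable random path. [folklore] -/
theorem measurable_brownian_pi : Measurable fun (ω : ℝ≥0 → ℝ) (u : ℝ≥0) ↦ Process.brownian u ω :=
  measurable_pi_lambda _ fun u ↦ Process.measurable_brownian u

/-! ### The weak Markov property at a fixed time, in integrated form -/

/-- **The increments after a fixed time have the law of the Brownian path** (as random elements of
`ℝ≥0 → ℝ`): all finite-dimensional laws agree, Mathlib's `IsPreBrownianReal.shift`.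
[cite: Legall2016, Prop. 2.5 (ii)] -/
theorem identDistrib_brownian_shift (r : ℝ≥0) :
    IdentDistrib (fun ω u ↦ Process.brownian (r + u) ω - Process.brownian r ω)
      (fun ω u ↦ Process.brownian u ω) Process.preWienerMeasure Process.preWienerMeasure := by
  haveI := isProbabilityMeasure_preWienerMeasure'
  have hB := isPreBrownianReal_brownian
  have hB' := hB.shift r
  have hm₁ : Measurable fun (ω : ℝ≥0 → ℝ) (u : ℝ≥0) ↦
      Process.brownian (r + u) ω - Process.brownian r ω :=
    measurable_pi_lambda _ fun u ↦
      (Process.measurable_brownian _).sub (Process.measurable_brownian _)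
  rw [identDistrib_iff_forall_finset_identDistrib hm₁.aemeasurable measurable_brownian_pi.aemeasurable]
  intro I
  exact ⟨(hB'.hasLaw I).aemeasurable, (hB.hasLaw I).aemeasurable,
    by rw [(hB'.hasLaw I).map_eq, (hB.hasLaw I).map_eq]⟩

/-- **The increments after a fixed time are independent of the past**, as σ-algebras: the
σ-algebra generated by the random path `u ↦ B_{r+u} - B_r` is independent of `𝓕ᵂ_r`
(Mathlib's `IsPreBrownianReal.indepFun_shift` and `brownianFiltration_eq_comap`).
[cite: Legall2016, Prop. 2.5 (ii)] -/
theorem indep_comap_brownian_shift (r : ℝ≥0) :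
    Indep (MeasurableSpace.comap (fun (ω : ℝ≥0 → ℝ) (u : ℝ≥0) ↦
        Process.brownian (r + u) ω - Process.brownian r ω) MeasurableSpace.pi)
      (brownianFiltration r) Process.preWienerMeasure := by
  have h := isPreBrownianReal_brownian.indepFun_shift r
  rw [IndepFun_iff_Indep] at h
  rwa [brownianFiltration_eq_comap]

/-- **Weak Markov property, integrated against an event of the past.** For `E ∈ 𝓕ᵂ_r` and a
measurable functional `G` of the path, `E[G(B_{r+·} - B_r); E] = E[G(B)] · P[E]` (for
unbounded non-integrable `G` both sides carry Mathlib's junk value of the Bochner integral and the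
identity still holds). [cite: Legall2016, Prop. 2.5 (ii)] -/
theorem setIntegral_comp_brownian_shift (r : ℝ≥0) {E : Set (ℝ≥0 → ℝ)}
    (hE : MeasurableSet[brownianFiltration r] E) {G : (ℝ≥0 → ℝ) → ℝ} (hGm : Measurable G) :
    ∫ ω in E, G (fun u ↦ Process.brownian (r + u) ω - Process.brownian r ω)
        ∂Process.preWienerMeasure =
      (∫ ω, G (fun u ↦ Process.brownian u ω) ∂Process.preWienerMeasure) *
        Process.preWienerMeasure.real E := by
  haveI := isProbabilityMeasure_preWienerMeasure'
  set Z : (ℝ≥0 → ℝ) → ℝ≥0 → ℝ := fun ω u ↦ Process.brownian (r + u) ω - Process.brownian r ω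
    with hZ
  have hZm : Measurable Z := measurable_pi_lambda _ fun u ↦
    (Process.measurable_brownian _).sub (Process.measurable_brownian _)
  have hEm : MeasurableSet E := (brownianFiltration.le r) _ hE
  -- independence of `G ∘ Z` and the indicator of `E`
  have hind : IndepFun (fun ω ↦ G (Z ω)) (E.indicator fun _ ↦ (1 : ℝ)) Process.preWienerMeasure := by
    rw [IndepFun_iff_Indep]
    refine indep_of_indep_of_le_right (indep_of_indep_of_le_left (indep_comap_brownian_shift r) ?_) ?_
    · exact (hGm.comp (comap_measurable Z)).comap_le
    · exact ((measurable_const (a := (1 : ℝ))).indicator hE).comap_le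
  -- law of `Z` is the law of `B`
  have hlaw : ∫ ω, G (Z ω) ∂Process.preWienerMeasure =
      ∫ ω, G (fun u ↦ Process.brownian u ω) ∂Process.preWienerMeasure := by
    have hid := (identDistrib_brownian_shift r).comp hGm
    exact hid.integral_eq
  calc ∫ ω in E, G (Z ω) ∂Process.preWienerMeasure
      = ∫ ω, G (Z ω) * E.indicator (fun _ ↦ (1 : ℝ)) ω ∂Process.preWienerMeasure := by
        rw [← integral_indicator hEm]
        congr 1; funext ω
        by_cases hω : ω ∈ E <;> simp [hω]
    _ = (∫ ω, G (Z ω) ∂Process.preWienerMeasure) *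
          ∫ ω, E.indicator (fun _ ↦ (1 : ℝ)) ω ∂Process.preWienerMeasure :=
        hind.integral_fun_mul_eq_mul_integral (hGm.comp hZm).aestronglyMeasurable
          ((measurable_const.indicator hEm).aestronglyMeasurable)
    _ = _ := by rw [hlaw, integral_indicator hEm, setIntegral_const, smul_eq_mul, mul_one]

/-! ### Stopping times with countably many values -/

/-- **Strong Markov property at a stopping time with countable range.** For a stopping time `τ`
of `𝓕ᵂ` taking countably many values, `A ∈ 𝓕ᵂ_τ`, and a bounded measurable functional `G` of the
path, `E[G(Z^τ); A ∩ {τ < ∞}] = E[G(B)] · P[A ∩ {τ < ∞}]`: decompose along the values `q` of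
`τ`, where `A ∩ {τ = q} ∈ 𝓕ᵂ_q` and `Z^τ = B_{q+·} - B_q`, and apply the weak Markov property at
each `q`. Le Gall (2016), proof of Thm. 2.20, first step. [cite: Legall2016, Thm. 2.20] -/
theorem setIntegral_comp_brownianIncrAfter_of_countable_range
    {τ : (ℝ≥0 → ℝ) → WithTop ℝ≥0} (hτ : IsStoppingTime brownianFiltration τ)
    (hcount : (Set.range τ).Countable) {A : Set (ℝ≥0 → ℝ)}
    (hA : MeasurableSet[hτ.measurableSpace] A) {G : (ℝ≥0 → ℝ) → ℝ} (hGm : Measurable G)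
    {C : ℝ} (hGb : ∀ w, |G w| ≤ C) :
    ∫ ω in A ∩ {ω | τ ω ≠ ⊤}, G (fun u ↦ brownianIncrAfter τ u ω) ∂Process.preWienerMeasure =
      (∫ ω, G (fun u ↦ Process.brownian u ω) ∂Process.preWienerMeasure) *
        Process.preWienerMeasure.real (A ∩ {ω | τ ω ≠ ⊤}) := by
  haveI := isProbabilityMeasure_preWienerMeasure'
  -- the countable set of finite values
  set S : Set ℝ≥0 := {q | ((q : ℝ≥0) : WithTop ℝ≥0) ∈ Set.range τ} with hS
  have hSc : S.Countable := hcount.preimage WithTop.coe_injective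
  haveI : Countable S := hSc.to_subtype
  -- the pieces
  set E : S → Set (ℝ≥0 → ℝ) := fun q ↦ A ∩ {ω | τ ω = ((q : ℝ≥0) : WithTop ℝ≥0)} with hEdef
  have hAm : MeasurableSet A := hτ.measurableSpace_le _ hA
  have hEq : ∀ q : S, MeasurableSet[brownianFiltration (q : ℝ≥0)] (E q) := by
    intro q
    have h1 : MeasurableSet[hτ.measurableSpace] (E q) :=
      hA.inter (hτ.measurableSet_eq_of_countable_range' hcount _)
    exact (hτ.measurableSet_inter_eq_iff A (q : ℝ≥0)).1 h1
  have hEm : ∀ q : S, MeasurableSet (E q) := fun q ↦ (brownianFiltration.le _) _ (hEq q)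
  have hdisj : Pairwise (Disjoint on E) := by
    intro p q hpq
    rw [Function.onFun, Set.disjoint_left]
    rintro ω ⟨-, hp⟩ ⟨-, hq'⟩
    apply hpq
    apply Subtype.ext
    have : ((p : ℝ≥0) : WithTop ℝ≥0) = ((q : ℝ≥0) : WithTop ℝ≥0) := by
      rw [Set.mem_setOf_eq] at hp hq'
      rw [← hp, ← hq']
    exact_mod_cast this
  have hUnion : (⋃ q, E q) = A ∩ {ω | τ ω ≠ ⊤} := by
    ext ω
    simp only [Set.mem_iUnion, Set.mem_inter_iff, Set.mem_setOf_eq, hEdef]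
    constructor
    · rintro ⟨q, hωA, hq⟩
      exact ⟨hωA, by rw [hq]; exact WithTop.coe_ne_top⟩
    · rintro ⟨hωA, hne⟩
      obtain ⟨r, hr⟩ := WithTop.ne_top_iff_exists.1 hne
      exact ⟨⟨r, ⟨ω, hr.symm⟩⟩, hωA, hr.symm⟩
  -- integrability of the bounded integrand
  set g : (ℝ≥0 → ℝ) → ℝ := fun ω ↦ G (fun u ↦ brownianIncrAfter τ u ω) with hg
  have hgm : Measurable g := hGm.comp (measurable_brownianIncrAfter_pi hτ.measurable')
  have hC0 : 0 ≤ C := (abs_nonneg _).trans (hGb fun _ ↦ 0)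
  have hgi : Integrable g Process.preWienerMeasure :=
    (integrable_const C).mono' hgm.aestronglyMeasurable
      (Eventually.of_forall fun ω ↦ by rw [Real.norm_eq_abs]; exact hGb _)
  -- the sum over the pieces
  have hsum : HasSum (fun q ↦ ∫ ω in E q, g ω ∂Process.preWienerMeasure)
      (∫ ω in A ∩ {ω | τ ω ≠ ⊤}, g ω ∂Process.preWienerMeasure) := by
    rw [← hUnion]
    exact hasSum_integral_iUnion hEm hdisj hgi.integrableOn
  have hsum1 : HasSum (fun q ↦ Process.preWienerMeasure.real (E q))
      (Process.preWienerMeasure.real (A ∩ {ω | τ ω ≠ ⊤})) := by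
    have h := hasSum_integral_iUnion (f := fun _ ↦ (1 : ℝ)) (μ := Process.preWienerMeasure)
      hEm hdisj (integrable_const (1 : ℝ)).integrableOn
    rw [hUnion] at h
    simpa only [integral_const, smul_eq_mul, mul_one, Measure.restrict_apply MeasurableSet.univ,
      Set.univ_inter, measureReal_def] using h
  -- each piece, by the weak Markov property at `q`
  set K : ℝ := ∫ ω, G (fun u ↦ Process.brownian u ω) ∂Process.preWienerMeasure with hK
  have hpiece : ∀ q : S, ∫ ω in E q, g ω ∂Process.preWienerMeasure =
      K * Process.preWienerMeasure.real (E q) := by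
    intro q
    have hcongr : ∫ ω in E q, g ω ∂Process.preWienerMeasure =
        ∫ ω in E q, G (fun u ↦ Process.brownian ((q : ℝ≥0) + u) ω - Process.brownian (q : ℝ≥0) ω)
          ∂Process.preWienerMeasure := by
      refine setIntegral_congr_fun (hEm q) fun ω hω ↦ ?_
      simp only [hg]
      congr 1; funext u
      exact brownianIncrAfter_of_eq_coe hω.2 u
    rw [hcongr]
    exact setIntegral_comp_brownian_shift (q : ℝ≥0) (hEq q) hGm
  have hsum2 : HasSum (fun q ↦ ∫ ω in E q, g ω ∂Process.preWienerMeasure)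
      (K * Process.preWienerMeasure.real (A ∩ {ω | τ ω ≠ ⊤})) := by
    simp_rw [hpiece]
    exact hsum1.mul_left K
  exact hsum.unique hsum2

/-! ### Arbitrary stopping times -/

/-- The event `{τ < ∞}` of a stopping time of `𝓕ᵂ` is measurable. [folklore] -/
theorem measurableSet_ne_top {τ : (ℝ≥0 → ℝ) → WithTop ℝ≥0}
    (hτ : IsStoppingTime brownianFiltration τ) : MeasurableSet {ω | τ ω ≠ ⊤} :=
  hτ.measurableSet_eq_top.compl

/-- **Strong Markov property, integrated form** (Le Gall (2016), Thm. 2.20). For a stopping time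
`τ` of `𝓕ᵂ`, `A ∈ 𝓕ᵂ_τ`, and a functional `G` of the path which is bounded, measurable for the
product σ-algebra and continuous for the product topology (e.g. a bounded continuous function of
finitely many coordinates), `E[G(Z^τ); A ∩ {τ < ∞}] = E[G(B)] · P[A ∩ {τ < ∞}]`, where
`Z^τ_u = B_{τ+u} - B_τ`. Proof as printed: the dyadic approximations `τₙ = dyadicCeilTop n τ ↓ τ`
are stopping times with countable range and `A ∈ 𝓕ᵂ_{τₙ}`, so the countable case applies to each
`τₙ`; then `Z^{τₙ} → Z^τ` pointwise by continuity of the paths, and dominated convergence.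
[cite: Legall2016, Thm. 2.20] -/
theorem setIntegral_comp_brownianIncrAfter {τ : (ℝ≥0 → ℝ) → WithTop ℝ≥0}
    (hτ : IsStoppingTime brownianFiltration τ) {A : Set (ℝ≥0 → ℝ)}
    (hA : MeasurableSet[hτ.measurableSpace] A) {G : (ℝ≥0 → ℝ) → ℝ} (hGm : Measurable G)
    (hGc : Continuous G) {C : ℝ} (hGb : ∀ w, |G w| ≤ C) :
    ∫ ω in A ∩ {ω | τ ω ≠ ⊤}, G (fun u ↦ brownianIncrAfter τ u ω) ∂Process.preWienerMeasure =
      (∫ ω, G (fun u ↦ Process.brownian u ω) ∂Process.preWienerMeasure) *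
        Process.preWienerMeasure.real (A ∩ {ω | τ ω ≠ ⊤}) := by
  haveI := isProbabilityMeasure_preWienerMeasure'
  set τn : ℕ → (ℝ≥0 → ℝ) → WithTop ℝ≥0 := fun n ω ↦ dyadicCeilTop n (τ ω) with hτndef
  have hτn : ∀ n, IsStoppingTime brownianFiltration (τn n) := fun n ↦
    hτ.isOptionalTime.isStoppingTime_dyadicCeilTop n
  have hcount : ∀ n, (Set.range (τn n)).Countable := fun n ↦
    (countable_range_dyadicCeilTop n).mono (Set.range_comp_subset_range τ (dyadicCeilTop n))
  have hle : ∀ n ω, τ ω ≤ τn n ω := fun n ω ↦ le_dyadicCeilTop n (τ ω)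
  have hAn : ∀ n, MeasurableSet[(hτn n).measurableSpace] A := fun n ↦
    IsStoppingTime.measurableSpace_mono hτ (hτn n) (hle n) _ hA
  have hset : ∀ n, A ∩ {ω | τn n ω ≠ ⊤} = A ∩ {ω | τ ω ≠ ⊤} := by
    intro n
    ext ω
    simp only [Set.mem_inter_iff, Set.mem_setOf_eq, hτndef, and_congr_right_iff]
    intro _
    induction τ ω using WithTop.recTopCoe with
    | top => simp
    | coe r => simp only [dyadicCeilTop_coe, ne_eq, WithTop.coe_ne_top, not_false_eq_true]
  have hAm : MeasurableSet (A ∩ {ω | τ ω ≠ ⊤}) :=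
    (hτ.measurableSpace_le _ hA).inter (measurableSet_ne_top hτ)
  set K : ℝ := ∫ ω, G (fun u ↦ Process.brownian u ω) ∂Process.preWienerMeasure with hK
  -- the identity for each `τₙ`
  have hn : ∀ n, ∫ ω in A ∩ {ω | τ ω ≠ ⊤}, G (fun u ↦ brownianIncrAfter (τn n) u ω)
      ∂Process.preWienerMeasure = K * Process.preWienerMeasure.real (A ∩ {ω | τ ω ≠ ⊤}) := by
    intro n
    rw [← hset n]
    exact setIntegral_comp_brownianIncrAfter_of_countable_range (hτn n) (hcount n) (hAn n) hGm hGb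
  -- pointwise convergence on `{τ < ∞}`
  have hptw : ∀ ω, τ ω ≠ ⊤ → Tendsto (fun n ↦ G (fun u ↦ brownianIncrAfter (τn n) u ω)) atTop
      (𝓝 (G (fun u ↦ brownianIncrAfter τ u ω))) := by
    intro ω hω
    obtain ⟨r, hr⟩ := WithTop.ne_top_iff_exists.1 hω
    refine (hGc.tendsto _).comp ?_
    rw [tendsto_pi_nhds]
    intro u
    have h1 : ∀ n, brownianIncrAfter (τn n) u ω =
        Process.brownian (dyadicCeil n r + u) ω - Process.brownian (dyadicCeil n r) ω :=
      fun n ↦ brownianIncrAfter_of_eq_coe (by simp only [hτndef, ← hr, dyadicCeilTop_coe]) u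
    have h2 : brownianIncrAfter τ u ω = Process.brownian (r + u) ω - Process.brownian r ω :=
      brownianIncrAfter_of_eq_coe hr.symm u
    simp_rw [h1, h2]
    have hc := Process.continuous_brownian ω
    exact ((hc.tendsto _).comp ((tendsto_dyadicCeil r).add tendsto_const_nhds)).sub
      ((hc.tendsto _).comp (tendsto_dyadicCeil r))
  -- dominated convergence
  have hlim : Tendsto (fun n ↦ ∫ ω in A ∩ {ω | τ ω ≠ ⊤},
      G (fun u ↦ brownianIncrAfter (τn n) u ω) ∂Process.preWienerMeasure) atTop
      (𝓝 (∫ ω in A ∩ {ω | τ ω ≠ ⊤}, G (fun u ↦ brownianIncrAfter τ u ω)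
        ∂Process.preWienerMeasure)) := by
    refine tendsto_integral_of_dominated_convergence (fun _ ↦ C) (fun n ↦ ?_) (integrable_const C)
      (fun n ↦ Eventually.of_forall fun ω ↦ by rw [Real.norm_eq_abs]; exact hGb _) ?_
    · exact (hGm.comp (measurable_brownianIncrAfter_pi (hτn n).measurable')).aestronglyMeasurable
    · rw [ae_restrict_iff' hAm]
      exact Eventually.of_forall fun ω hω ↦ hptw ω hω.2
  have hconst : Tendsto (fun n ↦ ∫ ω in A ∩ {ω | τ ω ≠ ⊤},
      G (fun u ↦ brownianIncrAfter (τn n) u ω) ∂Process.preWienerMeasure) atTop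
      (𝓝 (K * Process.preWienerMeasure.real (A ∩ {ω | τ ω ≠ ⊤}))) := by
    simp_rw [hn]
    exact tendsto_const_nhds
  exact tendsto_nhds_unique hlim hconst

/-- `Finset.restrict` on the path space is continuous for the product topologies. [folklore] -/
theorem continuous_finsetRestrict (I : Finset ℝ≥0) :
    Continuous (I.restrict : (ℝ≥0 → ℝ) → (I → ℝ)) :=
  continuous_pi fun i ↦ continuous_apply (i : ℝ≥0)

/-- **Strong Markov property, measure form.** For a stopping time `τ` of `𝓕ᵂ` and `A ∈ 𝓕ᵂ_τ`,
the image of `P` restricted to `A ∩ {τ < ∞}` under the random path `Z^τ = B_{τ+·} - B_τ` is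
`P[A ∩ {τ < ∞}]` times the law of the Brownian path (as measures on `ℝ≥0 → ℝ` with the product
σ-algebra): the finite-dimensional marginals of the two sides are finite Borel measures on `ℝ^I`
with equal integrals of bounded continuous functions (`setIntegral_comp_brownianIncrAfter`), hence
equal, and a measure on the path space is the projective limit of its marginals
(`IsProjectiveLimit.unique`). [cite: Legall2016, Thm. 2.20] -/
theorem map_brownianIncrAfter_restrict_eq {τ : (ℝ≥0 → ℝ) → WithTop ℝ≥0}
    (hτ : IsStoppingTime brownianFiltration τ) {A : Set (ℝ≥0 → ℝ)}
    (hA : MeasurableSet[hτ.measurableSpace] A) :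
    (Process.preWienerMeasure.restrict (A ∩ {ω | τ ω ≠ ⊤})).map
        (fun ω u ↦ brownianIncrAfter τ u ω) =
      Process.preWienerMeasure (A ∩ {ω | τ ω ≠ ⊤}) •
        Process.preWienerMeasure.map (fun ω u ↦ Process.brownian u ω) := by
  haveI := isProbabilityMeasure_preWienerMeasure'
  set c : ℝ≥0∞ := Process.preWienerMeasure (A ∩ {ω | τ ω ≠ ⊤}) with hc
  set Z : (ℝ≥0 → ℝ) → ℝ≥0 → ℝ := fun ω u ↦ brownianIncrAfter τ u ω with hZ
  have hZm : Measurable Z := measurable_brownianIncrAfter_pi hτ.measurable'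
  set μ₁ : Measure (ℝ≥0 → ℝ) := (Process.preWienerMeasure.restrict (A ∩ {ω | τ ω ≠ ⊤})).map Z
    with hμ₁
  set μ₂ : Measure (ℝ≥0 → ℝ) :=
    c • Process.preWienerMeasure.map (fun ω u ↦ Process.brownian u ω) with hμ₂
  haveI hPB : IsProbabilityMeasure
      (Process.preWienerMeasure.map (fun (ω : ℝ≥0 → ℝ) (u : ℝ≥0) ↦ Process.brownian u ω)) :=
    Measure.isProbabilityMeasure_map measurable_brownian_pi.aemeasurable
  haveI : IsFiniteMeasure μ₂ := by
    refine ⟨?_⟩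
    rw [hμ₂, Measure.smul_apply, measure_univ, smul_eq_mul, mul_one]
    exact measure_lt_top _ _
  have hfdd : ∀ I : Finset ℝ≥0, μ₁.map I.restrict = μ₂.map I.restrict := by
    intro I
    apply ext_of_forall_integral_eq_of_IsFiniteMeasure
    intro f
    have hfm : Measurable fun w : ℝ≥0 → ℝ ↦ f (I.restrict w) :=
      f.continuous.measurable.comp (Finset.measurable_restrict I)
    have hfb : ∀ w : ℝ≥0 → ℝ, |f (I.restrict w)| ≤ ‖f‖ := fun w ↦ by
      rw [← Real.norm_eq_abs]; exact f.norm_coe_le_norm _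
    rw [integral_map (Finset.measurable_restrict I).aemeasurable f.continuous.aestronglyMeasurable,
      integral_map (Finset.measurable_restrict I).aemeasurable f.continuous.aestronglyMeasurable,
      hμ₁, integral_map hZm.aemeasurable hfm.aestronglyMeasurable, hμ₂, integral_smul_measure,
      integral_map measurable_brownian_pi.aemeasurable hfm.aestronglyMeasurable]
    rw [setIntegral_comp_brownianIncrAfter hτ hA hfm (f.continuous.comp (continuous_finsetRestrict I))
      hfb]
    rw [measureReal_def, ← hc, smul_eq_mul, mul_comm]
  have h₁ : IsProjectiveLimit μ₁ (fun I : Finset ℝ≥0 ↦ μ₁.map I.restrict) := fun _ ↦ rfl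
  have h₂ : IsProjectiveLimit μ₂ (fun I : Finset ℝ≥0 ↦ μ₁.map I.restrict) := fun I ↦ (hfdd I).symm
  exact h₁.unique h₂

/-- **Strong Markov property, for events.** For a stopping time `τ` of `𝓕ᵂ`, `A ∈ 𝓕ᵂ_τ` and a
measurable set `S` of paths, `P[Z^τ ∈ S, A, τ < ∞] = P[B ∈ S] · P[A, τ < ∞]`.
[cite: Legall2016, Thm. 2.20] -/
theorem measure_brownianIncrAfter_mem_inter {τ : (ℝ≥0 → ℝ) → WithTop ℝ≥0}
    (hτ : IsStoppingTime brownianFiltration τ) {A : Set (ℝ≥0 → ℝ)}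
    (hA : MeasurableSet[hτ.measurableSpace] A) {S : Set (ℝ≥0 → ℝ)} (hS : MeasurableSet S) :
    Process.preWienerMeasure
        ((fun ω u ↦ brownianIncrAfter τ u ω) ⁻¹' S ∩ (A ∩ {ω | τ ω ≠ ⊤})) =
      Process.preWienerMeasure ((fun ω u ↦ Process.brownian u ω) ⁻¹' S) *
        Process.preWienerMeasure (A ∩ {ω | τ ω ≠ ⊤}) := by
  have hZm : Measurable fun (ω : ℝ≥0 → ℝ) (u : ℝ≥0) ↦ brownianIncrAfter τ u ω :=
    measurable_brownianIncrAfter_pi hτ.measurable'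
  have h := congrArg (fun μ : Measure (ℝ≥0 → ℝ) ↦ μ S) (map_brownianIncrAfter_restrict_eq hτ hA)
  rw [Measure.map_apply hZm hS, Measure.restrict_apply (hZm hS), Measure.smul_apply,
    Measure.map_apply measurable_brownian_pi hS, smul_eq_mul] at h
  rw [h, mul_comm]

/-! ### Almost surely finite stopping times -/

section Finite

variable {τ : (ℝ≥0 → ℝ) → WithTop ℝ≥0}

/-- For an a.s. finite stopping time, intersecting with `{τ < ∞}` does not change probabilities.
[folklore] -/
theorem measure_inter_ne_top (hfin : ∀ᵐ ω ∂Process.preWienerMeasure, τ ω ≠ ⊤)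
    (A : Set (ℝ≥0 → ℝ)) :
    Process.preWienerMeasure (A ∩ {ω | τ ω ≠ ⊤}) = Process.preWienerMeasure A := by
  apply measure_inter_conull
  rw [Set.compl_setOf]
  exact ae_iff.1 hfin

/-- For an a.s. finite stopping time, `{τ < ∞}` has probability one. [folklore] -/
theorem measure_ne_top_eq_one (hfin : ∀ᵐ ω ∂Process.preWienerMeasure, τ ω ≠ ⊤) :
    Process.preWienerMeasure {ω | τ ω ≠ ⊤} = 1 := by
  haveI := isProbabilityMeasure_preWienerMeasure'
  rw [← Set.univ_inter {ω | τ ω ≠ ⊤}, measure_inter_ne_top hfin, measure_univ]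

/-- **Strong Markov property, law** (Le Gall (2016), Thm. 2.20): for an a.s. finite stopping time
`τ` of `𝓕ᵂ`, the process `Z^τ_u = B_{τ+u} - B_τ` has the law of the Brownian path.
[cite: Legall2016, Thm. 2.20] -/
theorem identDistrib_brownianIncrAfter (hτ : IsStoppingTime brownianFiltration τ)
    (hfin : ∀ᵐ ω ∂Process.preWienerMeasure, τ ω ≠ ⊤) :
    IdentDistrib (fun ω u ↦ brownianIncrAfter τ u ω) (fun ω u ↦ Process.brownian u ω)
      Process.preWienerMeasure Process.preWienerMeasure := by
  haveI := isProbabilityMeasure_preWienerMeasure'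
  have hZm : Measurable fun (ω : ℝ≥0 → ℝ) (u : ℝ≥0) ↦ brownianIncrAfter τ u ω :=
    measurable_brownianIncrAfter_pi hτ.measurable'
  refine ⟨hZm.aemeasurable, measurable_brownian_pi.aemeasurable, ?_⟩
  have h := map_brownianIncrAfter_restrict_eq hτ (A := Set.univ)
    (@MeasurableSet.univ _ hτ.measurableSpace)
  have hfin' : ∀ᵐ ω ∂Process.preWienerMeasure, ω ∈ {ω | τ ω ≠ ⊤} := hfin
  rw [Set.univ_inter, Measure.restrict_eq_self_of_ae_mem hfin', measure_ne_top_eq_one hfin,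
    one_smul] at h
  exact h

/-- **Strong Markov property, independence** (Le Gall (2016), Thm. 2.20): for an a.s. finite
stopping time `τ` of `𝓕ᵂ`, the σ-algebra generated by `Z^τ = B_{τ+·} - B_τ` is independent of
`𝓕ᵂ_τ`. [cite: Legall2016, Thm. 2.20] -/
theorem indep_brownianIncrAfter (hτ : IsStoppingTime brownianFiltration τ)
    (hfin : ∀ᵐ ω ∂Process.preWienerMeasure, τ ω ≠ ⊤) :
    Indep (MeasurableSpace.comap (fun ω u ↦ brownianIncrAfter τ u ω) MeasurableSpace.pi)
      hτ.measurableSpace Process.preWienerMeasure := by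
  haveI := isProbabilityMeasure_preWienerMeasure'
  rw [Indep_iff]
  rintro t1 t2 ⟨S, hS, rfl⟩ ht2
  have h1 := measure_brownianIncrAfter_mem_inter hτ ht2 hS
  have h2 := measure_brownianIncrAfter_mem_inter hτ (@MeasurableSet.univ _ hτ.measurableSpace) hS
  rw [← Set.inter_assoc, measure_inter_ne_top hfin, measure_inter_ne_top hfin] at h1
  rw [Set.univ_inter, measure_inter_ne_top hfin, measure_ne_top_eq_one hfin, mul_one] at h2
  rw [h1, h2]

/-- **Strong Markov property, independence from `𝓕ᵂ_τ`-measurable data**: for an a.s. finite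
stopping time `τ`, `Z^τ` is independent of every `𝓕ᵂ_τ`-measurable random variable `X` (e.g.
`X = (τ, Y_τ)` for a continuous adapted `Y`). [cite: Legall2016, Thm. 2.20] -/
theorem indepFun_brownianIncrAfter {𝒳 : Type*} [MeasurableSpace 𝒳]
    (hτ : IsStoppingTime brownianFiltration τ)
    (hfin : ∀ᵐ ω ∂Process.preWienerMeasure, τ ω ≠ ⊤) {X : (ℝ≥0 → ℝ) → 𝒳}
    (hX : Measurable[hτ.measurableSpace] X) :
    IndepFun (fun ω u ↦ brownianIncrAfter τ u ω) X Process.preWienerMeasure := by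
  rw [IndepFun_iff_Indep]
  exact indep_of_indep_of_le_right (indep_brownianIncrAfter hτ hfin) hX.comap_le

/-- **Freezing formula at a stopping time** (the strong Markov property in the form used to
restart a stochastic differential equation at `τ`): for an a.s. finite stopping time `τ` of
`𝓕ᵂ`, an `𝓕ᵂ_τ`-measurable `X` and a bounded jointly measurable `F`,
`E[F(X, Z^τ)] = E_ω[E_{ω'}[F(X(ω), B(ω'))]]` — conditionally on `𝓕ᵂ_τ` the increments after `τ`
are a fresh Brownian motion. Le Gall (2016), Thm. 2.20 and its consequence (2.4);
Revuz–Yor (1999), Ch. III, Thm. (3.1). [cite: Legall2016, Thm. 2.20] -/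
theorem integral_brownianIncrAfter_eq_integral_integral {𝒳 : Type*} [MeasurableSpace 𝒳]
    (hτ : IsStoppingTime brownianFiltration τ)
    (hfin : ∀ᵐ ω ∂Process.preWienerMeasure, τ ω ≠ ⊤) {X : (ℝ≥0 → ℝ) → 𝒳}
    (hX : Measurable[hτ.measurableSpace] X) {F : 𝒳 → (ℝ≥0 → ℝ) → ℝ}
    (hFm : Measurable (Function.uncurry F)) {C : ℝ} (hFb : ∀ x w, |F x w| ≤ C) :
    ∫ ω, F (X ω) (fun u ↦ brownianIncrAfter τ u ω) ∂Process.preWienerMeasure =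
      ∫ ω, (∫ ω', F (X ω) (fun u ↦ Process.brownian u ω') ∂Process.preWienerMeasure)
        ∂Process.preWienerMeasure := by
  haveI := isProbabilityMeasure_preWienerMeasure'
  set Z : (ℝ≥0 → ℝ) → ℝ≥0 → ℝ := fun ω u ↦ brownianIncrAfter τ u ω with hZ
  have hZm : Measurable Z := measurable_brownianIncrAfter_pi hτ.measurable'
  have hXm : Measurable X := hX.mono hτ.measurableSpace_le le_rfl
  have hFint : ∀ (μ : Measure (𝒳 × (ℝ≥0 → ℝ))) [IsFiniteMeasure μ],
      Integrable (Function.uncurry F) μ := fun μ _ ↦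
    (integrable_const C).mono' hFm.aestronglyMeasurable (Eventually.of_forall fun p ↦ by
      rw [Real.norm_eq_abs]; exact hFb p.1 p.2)
  -- the pair `(X, Z)` has the product law
  have hind : IndepFun X Z Process.preWienerMeasure := (indepFun_brownianIncrAfter hτ hfin hX).symm
  have hpair : Process.preWienerMeasure.map (fun ω ↦ (X ω, Z ω)) =
      (Process.preWienerMeasure.map X).prod (Process.preWienerMeasure.map Z) :=
    (indepFun_iff_map_prod_eq_prod_map_map hXm.aemeasurable hZm.aemeasurable).1 hind
  haveI : IsProbabilityMeasure (Process.preWienerMeasure.map X) :=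
    Measure.isProbabilityMeasure_map hXm.aemeasurable
  haveI : IsProbabilityMeasure (Process.preWienerMeasure.map Z) :=
    Measure.isProbabilityMeasure_map hZm.aemeasurable
  have h1 : ∫ ω, F (X ω) (Z ω) ∂Process.preWienerMeasure =
      ∫ p, Function.uncurry F p ∂(Process.preWienerMeasure.map fun ω ↦ (X ω, Z ω)) := by
    rw [integral_map (hXm.prodMk hZm).aemeasurable hFm.aestronglyMeasurable]
    rfl
  rw [h1, hpair, integral_prod _ (hFint _), (identDistrib_brownianIncrAfter hτ hfin).map_eq]
  have h3 : ∀ x : 𝒳, ∫ w, Function.uncurry F (x, w)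
      ∂(Process.preWienerMeasure.map fun ω u ↦ Process.brownian u ω) =
      ∫ ω', F x (fun u ↦ Process.brownian u ω') ∂Process.preWienerMeasure := fun x ↦ by
    rw [integral_map measurable_brownian_pi.aemeasurable]
    · rfl
    · exact (hFm.comp (measurable_const.prodMk measurable_id)).aestronglyMeasurable
  simp_rw [h3]
  rw [integral_map hXm.aemeasurable]
  refine (Measurable.stronglyMeasurable ?_).aestronglyMeasurable
  exact (hFm.comp (measurable_fst.prodMk (measurable_brownian_pi.comp
    measurable_snd))).stronglyMeasurable.integral_prod_right' |>.measurable

end Finite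

end Literature.Probability.RandomPlanarGeometry
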